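import Summits.Ventures.LatticeQCDFlow.Scaling.TouchChainMoments

/-!
HONEST FRAMING: exact (Metropolis-corrected) sampling algorithms for lattice gauge theory; figures
of merit are autocorrelation/cost numbers at stated couplings and volumes; no continuum-physics
claim.

# DirtySetDecay — THE STALE SET OF THE HUB SCHEDULE EMPTIES GEOMETRICALLY: FOR THE SET-VALUED CHAIN
# `D ↦ σ_r(D)` (PROB. `t/m` EACH HUB ENTRY `r`, `σ_r` = THE TRANSPOSITION OF THE HOT LEVEL WITH `κ_r + 1`) AND
# `D ↦ D ∖ {0}` (PROB. `1 − t`), STARTED FROM EVERYTHING STALE, `P(D_n ≠ ∅) ≤ (K+1)·λⁿ/t` WITH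
# `λ = 1 − t(1−t)c/(2m)` (`c` = THE LEAST HUB MULTIPLICITY), HENCE `≤ ε` AFTER `(2m/(t(1−t)c))·log((K+1)/(tε))` STEPS
# (lean-2 GEN-24, ours)

Venture-side (OURS).  Cell `lqcd-flow` (pub-lqcd), unit `pub-lqcd-lean-2-g24`, 2026-08-27.  Chapter L (the coupon-collector
law from a cold start), file 12 — first file of the CEILING side.  For the hot-only hub with an EXACT hot sampler
(independent draws from the hot law) and perfect transports (all levels share one law, every swap accepted), a replica's
configuration is "stale" until its genealogy passes through a hot refresh; the set `D` of stale positions is moved by the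
swaps (the stale LABEL travels with the configuration: `D ↦ σ_r(D)`) and loses the hot position at each refresh
(`D ↦ D ∖ {0}`), autonomously of the configurations.  This file studies that set-valued chain ALONE, as a hypothesis-
equation kernel `Q(D,D') = Σ_r (t/m)·𝟙{D' = σ_r(D)} + (1−t)·𝟙{D' = D ∖ {0}}` on `Finset (Fin (K+1))`; the sequel shows
that the idealised star's distance to equilibrium at time `n` is at most `P(D_n ≠ ∅)`.

## What is proved

* §1 `swapLevel_*` bookkeeping; **`dirty_step_potential`** — for the potential `Φ(D) = Σ_{k∈D} φ_k`, `φ_0 = β`,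
  `φ_{k+1} = 1`: `Σ_{D'} Q(D,D')Φ(D') = Σ_{k∈D} ψ_k` with `ψ_0 = t`, `ψ_{p+1} = 1 − (t·c_p/m)(1 − β)`
  (`c_p = #{r : κ_r = p}`); **`dirty_step_potential_le`** — `t ≤ λβ` and `1 − (t·c_p/m)(1−β) ≤ λ` for all `p`
  ⇒ `QΦ ≤ λΦ`.
* §2 **`lawMean_lawAt_le_of_step_le`** — a non-negative sub-eigenfunction of a non-negative kernel decays geometrically in
  mean along the chain; **`dirty_nonempty_le`** — `0 < β ≤ 1` ⇒ `(δ_{univ} Qⁿ){D ≠ ∅} ≤ λⁿ·(K + β)/β`.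
* §3 the tuned constants `λ = 1 − t(1−t)c/(2m)`, `β = t/λ` (`1 ≤ c ≤ c_p`, `0 < t < 1`):
  **`dirty_nonempty_le_tuned`** — `(δ_{univ} Qⁿ){D ≠ ∅} ≤ (K+1)·λⁿ/t`; **`dirty_nonempty_le_of_ge_log`** —
  `n ≥ (2m/(t(1−t)c))·log((K+1)/(tε))` ⇒ `(δ_{univ} Qⁿ){D ≠ ∅} ≤ ε`.

Reading (no numerics implied): a stale label sitting at a cold position `p+1` waits a geometric time of rate `t·c_p/m`
to be swapped to the hot position, where it is destroyed with probability `1−t` per step before being swapped away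
again; the potential `β` at the hot position / `1` at cold positions turns this two-stage race into a one-step
contraction by `λ = 1 − t(1−t)c/(2m)`, uniformly in the number of stale labels.  NOT CLAIMED here: anything about
configurations (the sequel).  Literature grade (cell rule): OWN COMPOSITION (Lyapunov-function bound for a finite
chain); nothing cited as a fact; no new bib keys.
-/

noncomputable section

open Finset Function
open Literature.Probability.MarkovChains

namespace Summit.Ventures.LatticeQCDFlow.Scaling

variable {K m : ℕ} {t : ℝ} {Q : Finset (Fin (K + 1)) → Finset (Fin (K + 1)) → ℝ}

section Dirty
variable (κ : Fin m → Fin K)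

/-! ## §1 The one-step action of `Q` on the potential -/

/-- The transposition of the hot level with `κ_r + 1` fixes no cold level other than `κ_r + 1`:
`σ_r(p+1) = p+1` for `κ_r ≠ p`, and `σ_r(p+1) = 0` for `κ_r = p`; `σ_r(0) = κ_r + 1`. [ours] -/
theorem swapLevel_apply_succ (r : Fin m) (p : Fin K) :
    Equiv.swap (0 : Fin (K + 1)) (κ r).succ p.succ = if κ r = p then 0 else p.succ := by
  by_cases h : κ r = p
  · rw [if_pos h, ← h, Equiv.swap_apply_right]
  · rw [if_neg h, Equiv.swap_apply_of_ne_of_ne (Fin.succ_ne_zero p) (fun h' => h (Fin.succ_inj.mp h').symm)]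

/-- The potential of an image set: `Φ(σ(D)) = Σ_{k∈D} φ(σ k)` for a bijection `σ`. [ours] -/
theorem potential_image (σ : Equiv.Perm (Fin (K + 1))) (φ : Fin (K + 1) → ℝ) (D : Finset (Fin (K + 1))) :
    ∑ k ∈ D.image σ, φ k = ∑ k ∈ D, φ (σ k) :=
  Finset.sum_image fun _ _ _ _ h => σ.injective h

/-- The potential after a refresh: `Φ(D ∖ {0}) = Σ_{k∈D} 𝟙{k ≠ 0}·φ k`. [ours] -/
theorem potential_erase_zero (φ : Fin (K + 1) → ℝ) (D : Finset (Fin (K + 1))) :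
    ∑ k ∈ D.erase 0, φ k = ∑ k ∈ D, (if k = 0 then 0 else φ k) := by
  rw [← Finset.filter_ne' D 0, Finset.sum_filter]
  exact sum_congr rfl fun k _ => by by_cases h : k = 0 <;> simp [h]

/-- `Σ_r 𝟙{κ_r = p}·a + 𝟙{κ_r ≠ p}·b = c_p·a + (m − c_p)·b`. [ours] -/
theorem sum_ite_fiber (p : Fin K) (a b : ℝ) :
    ∑ r : Fin m, (if κ r = p then a else b)
      = ((univ.filter (fun r : Fin m => κ r = p)).card : ℝ) * a
        + ((m : ℝ) - ((univ.filter (fun r : Fin m => κ r = p)).card : ℝ)) * b := by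
  rw [← Finset.sum_filter_add_sum_filter_not univ (fun r : Fin m => κ r = p)]
  rw [Finset.sum_congr rfl (fun r hr => if_pos (Finset.mem_filter.mp hr).2),
    Finset.sum_congr rfl (fun r hr => if_neg (Finset.mem_filter.mp hr).2), sum_const, sum_const, nsmul_eq_mul,
    nsmul_eq_mul]
  have hc : ((univ.filter (fun r : Fin m => ¬κ r = p)).card : ℝ)
      = (m : ℝ) - ((univ.filter (fun r : Fin m => κ r = p)).card : ℝ) := by
    have h := Finset.card_filter_add_card_filter_not (s := (univ : Finset (Fin m))) (fun r : Fin m => κ r = p)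
    rw [card_univ, Fintype.card_fin] at h
    have h' : (((univ.filter (fun r : Fin m => κ r = p)).card : ℝ)
        + ((univ.filter (fun r : Fin m => ¬κ r = p)).card : ℝ)) = m := by exact_mod_cast h
    linarith
  rw [hc]

/-- **THE ONE-STEP ACTION OF `Q` ON THE POTENTIAL `Φ(D) = Σ_{k∈D} φ_k`, `φ_0 = β`, `φ_{p+1} = 1`:**
`Σ_{D'} Q(D,D')·Φ(D') = Σ_{k∈D} ψ_k` with `ψ_0 = t` and `ψ_{p+1} = 1 − (t·c_p/m)(1 − β)` (`m ≥ 1`). [ours] -/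
theorem dirty_step_potential (hm : 1 ≤ m)
    (hQ : ∀ D D', Q D D' = ∑ r : Fin m, t / m * (if D' = D.image (Equiv.swap (0 : Fin (K + 1)) (κ r).succ) then (1 : ℝ)
      else 0) + (1 - t) * (if D' = D.erase 0 then (1 : ℝ) else 0)) (β : ℝ) (D : Finset (Fin (K + 1))) :
    ∑ D', Q D D' * ∑ k ∈ D', (if k = (0 : Fin (K + 1)) then β else 1)
      = ∑ k ∈ D, (if k = (0 : Fin (K + 1)) then t else
          1 - t * ((univ.filter (fun r : Fin m => (κ r).succ = k)).card : ℝ) / m * (1 - β)) := by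
  have hmpos : (0 : ℝ) < m := Nat.cast_pos.mpr (by omega)
  set φ : Fin (K + 1) → ℝ := fun k => if k = (0 : Fin (K + 1)) then β else 1 with hφ
  -- (s1) integrate out `D'`
  have hs1 : ∑ D', Q D D' * ∑ k ∈ D', φ k
      = ∑ r : Fin m, t / m * ∑ k ∈ D.image (Equiv.swap (0 : Fin (K + 1)) (κ r).succ), φ k
        + (1 - t) * ∑ k ∈ D.erase 0, φ k := by
    simp_rw [hQ, add_mul, sum_mul, Finset.sum_add_distrib]
    congr 1
    · rw [Finset.sum_comm]
      refine sum_congr rfl fun r _ => ?_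
      simp_rw [mul_assoc, ← mul_sum]
      congr 1
      rw [Finset.sum_eq_single (D.image (Equiv.swap (0 : Fin (K + 1)) (κ r).succ))]
      · rw [if_pos rfl, one_mul]
      · intro D' _ h; rw [if_neg h, zero_mul]
      · intro h; exact absurd (mem_univ _) h
    · simp_rw [mul_assoc, ← mul_sum]
      congr 1
      rw [Finset.sum_eq_single (D.erase 0)]
      · rw [if_pos rfl, one_mul]
      · intro D' _ h; rw [if_neg h, zero_mul]
      · intro h; exact absurd (mem_univ _) h
  rw [hs1]
  simp_rw [potential_image, potential_erase_zero]
  -- (s4) regroup as a sum over `k ∈ D`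
  rw [show (∑ r : Fin m, t / m * ∑ k ∈ D, φ (Equiv.swap (0 : Fin (K + 1)) (κ r).succ k))
      = ∑ k ∈ D, ∑ r : Fin m, t / m * φ (Equiv.swap (0 : Fin (K + 1)) (κ r).succ k) by
    rw [Finset.sum_comm]; simp_rw [mul_sum], mul_sum, ← sum_add_distrib]
  refine sum_congr rfl fun k _ => ?_
  by_cases hk : k = 0
  · subst hk
    have h0 : ∀ r : Fin m, φ (Equiv.swap (0 : Fin (K + 1)) (κ r).succ 0) = 1 := fun r => by
      rw [hφ]; dsimp only; rw [Equiv.swap_apply_left, if_neg (Fin.succ_ne_zero _)]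
    have h00 : (if (0 : Fin (K + 1)) = 0 then (0 : ℝ) else φ 0) = 0 := if_pos rfl
    have hR : (if (0 : Fin (K + 1)) = 0 then t else
        1 - t * ((univ.filter (fun r : Fin m => (κ r).succ = 0)).card : ℝ) / m * (1 - β)) = t := if_pos rfl
    rw [h00, hR, mul_zero, add_zero]
    simp_rw [h0, mul_one, sum_const, card_univ, Fintype.card_fin, nsmul_eq_mul]
    field_simp
  · obtain ⟨p, rfl⟩ := Fin.exists_succ_eq.mpr hk
    rw [if_neg hk, hφ]
    simp only [if_neg hk, mul_one]
    have hsw : ∀ r : Fin m, (if Equiv.swap (0 : Fin (K + 1)) (κ r).succ p.succ = 0 then β else (1 : ℝ))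
        = if κ r = p then β else 1 := fun r => by
      rw [swapLevel_apply_succ κ r p]
      by_cases h : κ r = p
      · rw [if_pos h, if_pos rfl, if_pos h]
      · rw [if_neg h, if_neg (Fin.succ_ne_zero p), if_neg h]
    simp_rw [hsw, ← mul_sum, sum_ite_fiber κ p β 1]
    have hf : univ.filter (fun r : Fin m => (κ r).succ = p.succ) = univ.filter (fun r : Fin m => κ r = p) :=
      Finset.filter_congr fun r _ => Fin.succ_inj
    rw [hf]
    field_simp
    ring

/-- **`QΦ ≤ λΦ`** whenever `t ≤ λβ` and `1 − (t·c_p/m)(1 − β) ≤ λ` for every cold level (`c_p = #{r : κ_r = p}`),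
`0 ≤ β`. [ours] -/
theorem dirty_step_potential_le (hm : 1 ≤ m)
    (hQ : ∀ D D', Q D D' = ∑ r : Fin m, t / m * (if D' = D.image (Equiv.swap (0 : Fin (K + 1)) (κ r).succ) then (1 : ℝ)
      else 0) + (1 - t) * (if D' = D.erase 0 then (1 : ℝ) else 0)) {β lam : ℝ} (hl0 : t ≤ lam * β)
    (hlp : ∀ p : Fin K, 1 - t * ((univ.filter (fun r : Fin m => κ r = p)).card : ℝ) / m * (1 - β) ≤ lam)
    (D : Finset (Fin (K + 1))) :
    ∑ D', Q D D' * ∑ k ∈ D', (if k = (0 : Fin (K + 1)) then β else 1)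
      ≤ lam * ∑ k ∈ D, (if k = (0 : Fin (K + 1)) then β else 1) := by
  rw [dirty_step_potential κ hm hQ β D, mul_sum]
  refine sum_le_sum fun k _ => ?_
  by_cases hk : k = 0
  · subst hk; rw [if_pos rfl, if_pos rfl]; exact hl0
  · obtain ⟨p, rfl⟩ := Fin.exists_succ_eq.mpr hk
    rw [if_neg hk, if_neg hk, mul_one]
    have hf : univ.filter (fun r : Fin m => (κ r).succ = p.succ) = univ.filter (fun r : Fin m => κ r = p) :=
      Finset.filter_congr fun r _ => Fin.succ_inj
    rw [hf]; exact hlp p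

/-! ## §2 Geometric decay of the potential and of `P(D_n ≠ ∅)` -/

/-- **A non-negative sub-eigenfunction decays geometrically in mean:** `Q` a transition matrix, `λ ≥ 0`,
`QΦ ≤ λΦ` pointwise, `μ ≥ 0` ⇒ `E_{μQⁿ}Φ ≤ λⁿ·E_μΦ`. [ours] -/
theorem lawMean_lawAt_le_of_step_le {X : Type*} [Fintype X] {Q : X → X → ℝ} (hQ : IsRowStochastic Q) {Φ : X → ℝ}
    {lam : ℝ} (hlam : 0 ≤ lam) (hstep : ∀ D, ∑ D', Q D D' * Φ D' ≤ lam * Φ D) {μ : X → ℝ} (hμ : ∀ D, 0 ≤ μ D) :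
    ∀ n : ℕ, lawMean (lawAt Q μ n) Φ ≤ lam ^ n * lawMean μ Φ := by
  intro n
  induction n with
  | zero => rw [lawAt_zero, pow_zero, one_mul]
  | succ n ih =>
    rw [lawAt_succ, lawMean_stepLaw]
    have hnn : ∀ D, 0 ≤ lawAt Q μ n D := fun D => lawAt_nonneg hQ hμ n D
    calc lawMean (lawAt Q μ n) (fun D => ∑ D', Q D D' * Φ D')
        ≤ lawMean (lawAt Q μ n) (fun D => lam * Φ D) :=
          sum_le_sum fun D _ => mul_le_mul_of_nonneg_left (hstep D) (hnn D)
      _ = lam * lawMean (lawAt Q μ n) Φ := by unfold lawMean; rw [mul_sum]; exact sum_congr rfl fun D _ => by ring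
      _ ≤ lam * (lam ^ n * lawMean μ Φ) := mul_le_mul_of_nonneg_left ih hlam
      _ = lam ^ (n + 1) * lawMean μ Φ := by ring

/-- The set chain `Q` is a transition matrix (`0 ≤ t ≤ 1`, `m ≥ 1`). [ours] -/
theorem dirty_isRowStochastic (hm : 1 ≤ m) (ht0 : 0 ≤ t) (ht1 : t ≤ 1)
    (hQ : ∀ D D', Q D D' = ∑ r : Fin m, t / m * (if D' = D.image (Equiv.swap (0 : Fin (K + 1)) (κ r).succ) then (1 : ℝ)
      else 0) + (1 - t) * (if D' = D.erase 0 then (1 : ℝ) else 0)) : IsRowStochastic Q := by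
  have hmpos : (0 : ℝ) < m := Nat.cast_pos.mpr (by omega)
  refine ⟨fun D D' => ?_, fun D => ?_⟩
  · rw [hQ]
    exact add_nonneg (sum_nonneg fun r _ => mul_nonneg (by positivity) (by split_ifs <;> norm_num))
      (mul_nonneg (by linarith) (by split_ifs <;> norm_num))
  · simp_rw [hQ, Finset.sum_add_distrib]
    rw [Finset.sum_comm]
    simp_rw [← mul_sum, Finset.sum_ite_eq' univ, if_pos (mem_univ _), mul_one, sum_const, card_univ, Fintype.card_fin,
      nsmul_eq_mul]
    have e : t / (m : ℝ) * ((m : ℝ) * 1) + (1 - t) = 1 := by field_simp; ring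
    exact e

/-- **`P(D_n ≠ ∅) ≤ λⁿ·(K + β)/β`:** with `0 < β ≤ 1`, `0 ≤ λ` and the two contraction conditions, the set chain started
from everything stale (`D_0 = univ`) satisfies `(δ_{univ} Qⁿ){D ≠ ∅} ≤ λⁿ(K + β)/β`. [ours] -/
theorem dirty_nonempty_le (hm : 1 ≤ m) (ht0 : 0 ≤ t) (ht1 : t ≤ 1)
    (hQ : ∀ D D', Q D D' = ∑ r : Fin m, t / m * (if D' = D.image (Equiv.swap (0 : Fin (K + 1)) (κ r).succ) then (1 : ℝ)
      else 0) + (1 - t) * (if D' = D.erase 0 then (1 : ℝ) else 0)) {β lam : ℝ} (hβ0 : 0 < β) (hβ1 : β ≤ 1)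
    (hlam : 0 ≤ lam) (hl0 : t ≤ lam * β)
    (hlp : ∀ p : Fin K, 1 - t * ((univ.filter (fun r : Fin m => κ r = p)).card : ℝ) / m * (1 - β) ≤ lam) (n : ℕ) :
    ∑ D ∈ univ.filter (fun D : Finset (Fin (K + 1)) => D ≠ ∅), lawAt Q (Pi.single (univ : Finset (Fin (K + 1))) 1) n D
      ≤ lam ^ n * ((K : ℝ) + β) / β := by
  set ρ := lawAt Q (Pi.single (univ : Finset (Fin (K + 1))) 1) n with hρ
  have hQst := dirty_isRowStochastic κ hm ht0 ht1 hQ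
  have hρ0 : ∀ D, 0 ≤ ρ D := fun D => lawAt_nonneg hQst (fun U => by
    by_cases h : U = univ
    · subst h; rw [Pi.single_eq_same]; norm_num
    · rw [Pi.single_eq_of_ne h]) n D
  -- `β·𝟙{D ≠ ∅} ≤ Φ(D)`
  have hΦge : ∀ D : Finset (Fin (K + 1)), β * (if D ≠ ∅ then (1 : ℝ) else 0)
      ≤ ∑ k ∈ D, (if k = (0 : Fin (K + 1)) then β else 1) := by
    intro D
    split_ifs with hD
    · obtain ⟨k, hk⟩ := Finset.nonempty_iff_ne_empty.mpr hD
      rw [mul_one]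
      refine le_trans ?_ (Finset.single_le_sum (f := fun k => if k = (0 : Fin (K + 1)) then β else (1 : ℝ))
        (fun j _ => by split_ifs <;> linarith) hk)
      split_ifs <;> linarith
    · rw [mul_zero]; exact sum_nonneg fun j _ => by split_ifs <;> linarith
  -- the mean potential decays
  have hdecay := lawMean_lawAt_le_of_step_le hQst hlam (dirty_step_potential_le κ hm hQ hl0 hlp)
    (μ := Pi.single (univ : Finset (Fin (K + 1))) 1) (fun U => by
      by_cases h : U = univ
      · subst h; rw [Pi.single_eq_same]; norm_num
      · rw [Pi.single_eq_of_ne h]) n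
  rw [lawMean_single] at hdecay
  have hΦuniv : ∑ k ∈ (univ : Finset (Fin (K + 1))), (if k = (0 : Fin (K + 1)) then β else (1 : ℝ)) = K + β := by
    rw [Fin.sum_univ_succ, if_pos rfl]
    simp_rw [if_neg (Fin.succ_ne_zero _), sum_const, card_univ, Fintype.card_fin, nsmul_eq_mul, mul_one]
    ring
  rw [hΦuniv] at hdecay
  -- assemble
  have hmass : β * ∑ D ∈ univ.filter (fun D : Finset (Fin (K + 1)) => D ≠ ∅), ρ D ≤ lawMean ρ
      (fun D => ∑ k ∈ D, (if k = (0 : Fin (K + 1)) then β else 1)) := by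
    unfold lawMean
    rw [Finset.sum_filter, mul_sum]
    refine sum_le_sum fun D _ => ?_
    have := mul_le_mul_of_nonneg_left (hΦge D) (hρ0 D)
    calc β * (if D ≠ ∅ then ρ D else 0) = ρ D * (β * if D ≠ ∅ then (1 : ℝ) else 0) := by split_ifs <;> ring
      _ ≤ ρ D * ∑ k ∈ D, (if k = (0 : Fin (K + 1)) then β else 1) := this
  rw [le_div_iff₀ hβ0]
  linarith

/-! ## §3 The tuned constants -/

/-- **THE TUNED CONTRACTION:** with `θ = t·c/m` (`1 ≤ c ≤ c_p` for all `p`, `c ≤ m`), `0 < t < 1`,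
`λ = 1 − θ(1−t)/2`, `β = t/λ`: `(δ_{univ} Qⁿ){D ≠ ∅} ≤ (K+1)·λⁿ/t`. [ours] -/
theorem dirty_nonempty_le_tuned (hm : 1 ≤ m) (ht0 : 0 < t) (ht1 : t < 1)
    (hQ : ∀ D D', Q D D' = ∑ r : Fin m, t / m * (if D' = D.image (Equiv.swap (0 : Fin (K + 1)) (κ r).succ) then (1 : ℝ)
      else 0) + (1 - t) * (if D' = D.erase 0 then (1 : ℝ) else 0)) {c : ℕ} (hc1 : 1 ≤ c)
    (hc : ∀ p : Fin K, c ≤ (univ.filter (fun r : Fin m => κ r = p)).card) (hcm : c ≤ m) (n : ℕ) :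
    ∑ D ∈ univ.filter (fun D : Finset (Fin (K + 1)) => D ≠ ∅), lawAt Q (Pi.single (univ : Finset (Fin (K + 1))) 1) n D
      ≤ ((K : ℝ) + 1) * (1 - t * (1 - t) * c / (2 * m)) ^ n / t := by
  have hmpos : (0 : ℝ) < m := Nat.cast_pos.mpr (by omega)
  have hcpos : (0 : ℝ) < c := Nat.cast_pos.mpr (by omega)
  have hcm' : (c : ℝ) ≤ m := by exact_mod_cast hcm
  set θ := t * c / m with hθ
  have hθpos : 0 < θ := by positivity
  have hθle : θ ≤ t := by
    rw [hθ, mul_div_assoc]; exact mul_le_of_le_one_right ht0.le ((div_le_one hmpos).mpr hcm')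
  set lam := 1 - θ * (1 - t) / 2 with hlam
  have hlam_pos : 0 < lam := by rw [hlam]; nlinarith
  have hlam_le : lam ≤ 1 := by rw [hlam]; nlinarith
  have htlam : t ≤ lam := by rw [hlam]; nlinarith
  set β := t / lam with hβ
  have hβ0 : 0 < β := div_pos ht0 hlam_pos
  have hβ1 : β ≤ 1 := (div_le_one hlam_pos).mpr htlam
  have hl0 : t ≤ lam * β := by
    have e : lam * (t / lam) = t := by field_simp
    rw [hβ, e]
  -- the cold condition: `1 − (t c_p/m)(1−β) ≤ 1 − θ(1−β) ≤ λ`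
  have hkey : 1 - θ * (1 - β) ≤ lam := by
    -- `θ(1−β) ≥ θ(1−t)/2 ⇔ 1 − β ≥ (1−t)/2 ⇔ β ≤ (1+t)/2 ⇔ 2t ≤ (1+t)λ`
    have h2 : 2 * t ≤ (1 + t) * lam := by rw [hlam]; nlinarith [mul_pos ht0 hθpos]
    have hβle : β ≤ (1 + t) / 2 := by
      rw [hβ, div_le_div_iff₀ hlam_pos (by norm_num : (0:ℝ) < 2)]; linarith
    rw [hlam]; nlinarith
  have hlp : ∀ p : Fin K, 1 - t * ((univ.filter (fun r : Fin m => κ r = p)).card : ℝ) / m * (1 - β) ≤ lam := by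
    intro p
    have hcp : θ ≤ t * ((univ.filter (fun r : Fin m => κ r = p)).card : ℝ) / m := by
      rw [hθ]; exact div_le_div_of_nonneg_right (mul_le_mul_of_nonneg_left (by exact_mod_cast hc p) ht0.le) hmpos.le
    nlinarith [hcp, hβ1]
  have h := dirty_nonempty_le κ hm ht0.le ht1.le hQ hβ0 hβ1 hlam_pos.le hl0 hlp n
  have hKβ : ((K : ℝ) + β) / β ≤ ((K : ℝ) + 1) / t := by
    rw [div_le_div_iff₀ hβ0 ht0]
    have : β ≥ t := by rw [hβ, ge_iff_le, le_div_iff₀ hlam_pos]; nlinarith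
    nlinarith [hβ1, (Nat.cast_nonneg K : (0:ℝ) ≤ K)]
  have hlamθ : lam = 1 - t * (1 - t) * c / (2 * m) := by rw [hlam, hθ]; field_simp
  calc ∑ D ∈ univ.filter (fun D : Finset (Fin (K + 1)) => D ≠ ∅),
        lawAt Q (Pi.single (univ : Finset (Fin (K + 1))) 1) n D ≤ lam ^ n * ((K : ℝ) + β) / β := h
    _ = lam ^ n * (((K : ℝ) + β) / β) := by ring
    _ ≤ lam ^ n * (((K : ℝ) + 1) / t) := mul_le_mul_of_nonneg_left hKβ (pow_nonneg hlam_pos.le n)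
    _ = ((K : ℝ) + 1) * (1 - t * (1 - t) * c / (2 * m)) ^ n / t := by rw [← hlamθ]; ring

/-- **THE STALE SET IS EMPTY AFTER `(2m/(t(1−t)c))·log((K+1)/(tε))` STEPS, except with probability `≤ ε`.** [ours] -/
theorem dirty_nonempty_le_of_ge_log (hm : 1 ≤ m) (ht0 : 0 < t) (ht1 : t < 1)
    (hQ : ∀ D D', Q D D' = ∑ r : Fin m, t / m * (if D' = D.image (Equiv.swap (0 : Fin (K + 1)) (κ r).succ) then (1 : ℝ)
      else 0) + (1 - t) * (if D' = D.erase 0 then (1 : ℝ) else 0)) {c : ℕ} (hc1 : 1 ≤ c)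
    (hc : ∀ p : Fin K, c ≤ (univ.filter (fun r : Fin m => κ r = p)).card) (hcm : c ≤ m) {ε : ℝ} (hε : 0 < ε) {n : ℕ}
    (hn : 2 * (m : ℝ) / (t * (1 - t) * c) * Real.log (((K : ℝ) + 1) / (t * ε)) ≤ n) :
    ∑ D ∈ univ.filter (fun D : Finset (Fin (K + 1)) => D ≠ ∅), lawAt Q (Pi.single (univ : Finset (Fin (K + 1))) 1) n D
      ≤ ε := by
  have hmpos : (0 : ℝ) < m := Nat.cast_pos.mpr (by omega)
  have hcpos : (0 : ℝ) < c := Nat.cast_pos.mpr (by omega)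
  have hcm' : (c : ℝ) ≤ m := by exact_mod_cast hcm
  have hK1 : (0 : ℝ) < (K : ℝ) + 1 := by positivity
  set a := t * (1 - t) * c / (2 * m) with ha
  have hapos : 0 < a := by rw [ha]; exact div_pos (mul_pos (mul_pos ht0 (by linarith)) hcpos) (by positivity)
  have hale : a ≤ 1 := by
    rw [ha, div_le_one (by positivity)]
    have h1 : t * (1 - t) ≤ 1 := by nlinarith
    have h2 : t * (1 - t) * c ≤ 1 * c := mul_le_mul_of_nonneg_right h1 hcpos.le
    linarith
  refine (dirty_nonempty_le_tuned κ hm ht0 ht1 hQ hc1 hc hcm n).trans ?_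
  -- `(K+1)(1−a)ⁿ/t ≤ (K+1)e^{−na}/t ≤ ε`
  have hna : Real.log (((K : ℝ) + 1) / (t * ε)) ≤ n * a := by
    have h := mul_le_mul_of_nonneg_right hn hapos.le
    have h1t : (1 : ℝ) - t ≠ 0 := (sub_pos.mpr ht1).ne'
    have e : 2 * (m : ℝ) / (t * (1 - t) * c) * Real.log (((K : ℝ) + 1) / (t * ε)) * a
        = Real.log (((K : ℝ) + 1) / (t * ε)) := by
      rw [ha]; field_simp
    linarith [e]
  have hpow : (1 - a) ^ n ≤ Real.exp (-(n * a)) := by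
    calc (1 - a) ^ n ≤ (Real.exp (-a)) ^ n := by
          apply pow_le_pow_left₀ (by linarith)
          have := Real.add_one_le_exp (-a); linarith
      _ = Real.exp (-(n * a)) := by rw [← Real.exp_nat_mul]; ring_nf
  have hexp : Real.exp (-(n * a)) ≤ t * ε / ((K : ℝ) + 1) := by
    calc Real.exp (-(n * a)) ≤ Real.exp (-Real.log (((K : ℝ) + 1) / (t * ε))) := Real.exp_le_exp.mpr (by linarith)
      _ = t * ε / ((K : ℝ) + 1) := by rw [Real.exp_neg, Real.exp_log (by positivity), inv_div]
  calc ((K : ℝ) + 1) * (1 - a) ^ n / t ≤ ((K : ℝ) + 1) * (t * ε / ((K : ℝ) + 1)) / t := by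
        gcongr
        exact hpow.trans hexp
    _ = ε := by field_simp

end Dirty



end Summit.Ventures.LatticeQCDFlow.Scaling

end
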